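import Literature.NumberTheory.LFunctions.VinogradovKorobovDirichlet
import Literature.Barriers.Parity.PrimeLevelTransitionZeroFreeBox

/-!
# Route `PrimeLevelFamEdge` — TYPED IDEA DELTAS, deck 29 (LANDING NOTE typer ls-idea-typ-1 gen 4: lens-21 g7's
# `HOME/ls-idea-lens-21/g7/Sketch_L21g7_GaussDiscount.lean` sha16 fe8caa9339187c4d VERBATIM up to namespace
# `…Cruxes.BeyondDiagonalBeatsQuarter.L21g7S` → `…Theorems.PrimeLevelFamEdgeIdeaDeltas.GaussDiscount`; card K-L21-9
# `idea-l21-a8s-gauss-discount.md` (tree dc33d64aa9259e5a); desk NOTICE l.2977 priority (i); critic E b24 PASS (byte copy rc 0, axioms std,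
# planted-false checked), C b151; one docstring added (lint).)
#
# lens-21 g7, desk task U3-21 — the SMALL-CONDUCTOR residual (S) = a8S-short of K_B's heart:
# the Gauss discount, the discounted family zero sum (First lemma, TYPED), and the χ-face of W-R⋆

Pencil ledger (card `l21-a8s-gauss-discount`): in the (S) rows a zero `ρ` of `L(s,ψ)`, `cond ψ = d`, enters
with the principal's per-zero unit times the GAUSS DISCOUNT `d^{-1/2}·(d/φ(d))` (tree identities
`OffDiagCharacterBlock.tsum_char_mul_fourier2_shift_eq_samples`, `OffDiagCharacterSublattice.…`: coefficient
`(𝓕χ)(j) = χ̄(−j)τ(χ)`, `|τ(ψ)| = √d`, at every box height, weight `B√d/φ(dt)` over the short cofactor `t`).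
TRANSITION rows: after the same (c)×(b) as the principal the zero side is the discounted family sum below,
which → 0 world-free (tree `VKZeta.exists_hasVKZeroFreeRegion` for `d ≤ e^{√L}`, the discount for `d > e^{√L}`,
family log-free density `MontgomeryVaughan1975.gallagher1970_logFreeDensity` conj. 2 for the count, the
effective `1 − β₁ ≫ d₁^{-1/2}log^{-2}d₁` for the exceptional zero). CROWN rows (mass unit `≍ q̂^η·ms`): the
χ-face `ChiFace` must hold; its i.o. form is the half-plane `QuasiGRHFamily (1 − η/2)` by NESTING (proved
below: twin of `Literature.Barriers.Parity.fundingBoxIO_iff_quasiRH`). Nothing here bounds (S), U or K_B;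
`DiscountedFamilyZeroSum` is TYPED, not proved. No exceptional-zero theorem is proved by this file.
-/

namespace Summit.Parity.GeneralizedHardyLittlewood.Theorems.PrimeLevelFamEdgeIdeaDeltas.GaussDiscount

open Literature.NumberTheory.LFunctions

open scoped Classical in
/-- **First lemma (TYPED, pencil-true): the Gauss-discounted family zero sum vanishes.** Over arbitrary finite
sets `Z(q,χ)` of non-trivial zeros of `L(s,χ)` of height `≤ N^κ` (the interface of
`gallagher1970_logFreeDensity`), conductors `q ≤ N^θ` (`θ = 3η`, `κ = η/2 + ε` on the K_B line):
`Σ_{q ≤ N^θ} q^{-1/2} Σ_{χ mod q primitive} Σ_{ρ ∈ Z(q,χ)} N^{Re ρ − 1} → 0`. Pencil rate: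
`C_D(e^{−(1−c_Dθ')cL^{1/3}} + e^{−√L/2}) + e·log²L/(c_E·L)`, `L = log N`, valid when `c_D·max(θ, 6κ)… < 1`
(log-free count beaten by `N^{σ−1}`); the last term is the exceptional zero, discounted by its own Gauss sum.
Modulus `q'+1`, `q' ≥ 1`, as in `gallagher1970_logFreeDensity` (so that `LFunction` has its `NeZero`). -/
def DiscountedFamilyZeroSum (θ κ : ℝ) : Prop :=
  ∀ ε : ℝ, 0 < ε → ∃ N₀ : ℝ, ∀ N : ℝ, N₀ ≤ N →
    ∀ Z : (q : ℕ) → DirichletCharacter ℂ q → Finset ℂ,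
      (∀ (q' : ℕ) (χ : DirichletCharacter ℂ (q' + 1)), ∀ ρ ∈ Z (q' + 1) χ,
          χ.LFunction ρ = 0 ∧ 0 < ρ.re ∧ ρ.re < 1 ∧ |ρ.im| ≤ N ^ κ) →
      ∑ q' ∈ Finset.Ico 1 ⌊N ^ θ⌋₊, ((q' : ℝ) + 1) ^ (-(1 / 2 : ℝ)) *
          ∑ χ : DirichletCharacter ℂ (q' + 1) with χ.IsPrimitive,
            ∑ ρ ∈ Z (q' + 1) χ, N ^ (ρ.re - 1) ≤ ε

/-- **Quasi-GRH at abscissa `σ` for the whole Dirichlet family** (every modulus, `ζ` = modulus 1 included):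
no `L(s,χ)` vanishes with `σ < Re s < 1`. -/
def QuasiGRHFamily (σ : ℝ) : Prop :=
  ∀ (d : ℕ) [NeZero d] (χ : DirichletCharacter ℂ d) (ρ : ℂ), χ.LFunction ρ = 0 → σ < ρ.re → ρ.re < 1 → False

/-- **The χ-face of W-R⋆ at scale `N`** (crown rows of (S), conductor-graded): every `L(s,χ)` with conductor
`d ≤ N^η` has no zero with `|Im| ≤ (log N)^s` and `Re > 1 − (η − log d/log N)/2` — the abscissa relaxes with the
conductor (Gauss discount) and reaches `1` at `d = N^η`; `d = 1` is the principal face (without the `Δ′`). -/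
def ChiFace (η s N : ℝ) : Prop :=
  ∀ (d : ℕ) [NeZero d] (χ : DirichletCharacter ℂ d), (d : ℝ) ≤ N ^ η →
    ∀ ρ : ℂ, χ.LFunction ρ = 0 → |ρ.im| ≤ Real.log N ^ s → ρ.re < 1 →
      ρ.re ≤ 1 - (η - Real.log d / Real.log N) / 2

/-- The χ-face infinitely often in the scale (what the `_io` heart would consume for the crown rows of (S)). -/
def ChiFaceIO (η s : ℝ) : Prop :=
  ∀ N₀ : ℝ, ∃ N : ℝ, N₀ ≤ N ∧ ChiFace η s N

/-- The half-plane gives the face at every scale `N ≥ 1` (trivial direction). -/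
theorem chiFace_of_quasiGRHFamily {η s N : ℝ} (h : QuasiGRHFamily (1 - η / 2)) (hN : 1 ≤ N) :
    ChiFace η s N := by
  intro d _ χ _ ρ hρ _ hre
  have h1 : ρ.re ≤ 1 - η / 2 := not_lt.mp fun hlt => h d χ ρ hρ hlt hre
  have h2 : 0 ≤ Real.log d / Real.log N := div_nonneg (Real.log_natCast_nonneg d) (Real.log_nonneg hN)
  linarith

/-- Bookkeeping: the quasi-GRH family hypothesis at `1 − η/2` funds the `χ`-face i.o. clause (LANDING NOTE: docstring added by the
typer; statement and proof are the seat's). -/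
theorem chiFaceIO_of_quasiGRHFamily {η s : ℝ} (h : QuasiGRHFamily (1 - η / 2)) : ChiFaceIO η s :=
  fun N₀ => ⟨max N₀ 1, le_max_left _ _, chiFace_of_quasiGRHFamily h (le_max_right _ _)⟩

/-- **NESTING: the i.o. χ-face is already the half-plane** (twin of `fundingBoxIO_iff_quasiRH`): a zero `ρ₀` of
one `L(s,χ₀)` with `Re ρ₀ > 1 − η/2` lies inside the face's box at every large scale (its conductor is eventually
`≤ N^η`, its height eventually `≤ (log N)^s`, and the conductor relief `log d/(2 log N) → 0`). -/
theorem quasiGRHFamily_of_chiFaceIO {η s : ℝ} (hη : 0 < η) (hs : 0 < s) (hIO : ChiFaceIO η s) :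
    QuasiGRHFamily (1 - η / 2) := by
  intro d _ χ ρ hρ hσ hre
  -- the margin of the offending zero
  set ε₀ : ℝ := ρ.re - (1 - η / 2) with hε₀_def
  have hε₀ : 0 < ε₀ := by rw [hε₀_def]; linarith
  have hd1 : (1 : ℝ) ≤ d := by exact_mod_cast Nat.one_le_iff_ne_zero.mpr (NeZero.ne d)
  have hlogd : 0 ≤ Real.log d := Real.log_nonneg hd1
  -- thresholds: conductor inside, height inside, relief below the margin, and N ≥ 3
  set N₀ : ℝ := max (max ((d : ℝ) ^ (1 / η)) (Real.exp (|ρ.im| ^ (1 / s))))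
    (max (Real.exp (Real.log d / (2 * ε₀) + 1)) 3) with hN₀_def
  obtain ⟨N, hN₀N, hface⟩ := hIO N₀
  have hN3 : 3 ≤ N := le_trans (le_trans (le_max_right _ _) (le_max_right _ _)) hN₀N
  have hNpos : 0 < N := by linarith
  have hlogN : 0 < Real.log N := Real.log_pos (by linarith)
  -- (a) conductor inside the box
  have ha : (d : ℝ) ≤ N ^ η := by
    have h1 : (d : ℝ) ^ (1 / η) ≤ N := le_trans (le_trans (le_max_left _ _) (le_max_left _ _)) hN₀N
    have h2 : ((d : ℝ) ^ (1 / η)) ^ η ≤ N ^ η :=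
      Real.rpow_le_rpow (Real.rpow_nonneg (by linarith) _) h1 hη.le
    have h3 : ((d : ℝ) ^ (1 / η)) ^ η = d := by
      rw [← Real.rpow_mul (by linarith), one_div_mul_cancel hη.ne', Real.rpow_one]
    rw [h3] at h2; exact h2
  -- (b) height inside the box
  have hb : |ρ.im| ≤ Real.log N ^ s := by
    have h1 : Real.exp (|ρ.im| ^ (1 / s)) ≤ N := le_trans (le_trans (le_max_right _ _) (le_max_left _ _)) hN₀N
    have h2 : |ρ.im| ^ (1 / s) ≤ Real.log N := (Real.le_log_iff_exp_le hNpos).mpr h1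
    have h3 : (|ρ.im| ^ (1 / s)) ^ s ≤ Real.log N ^ s :=
      Real.rpow_le_rpow (Real.rpow_nonneg (abs_nonneg _) _) h2 hs.le
    have h4 : (|ρ.im| ^ (1 / s)) ^ s = |ρ.im| := by
      rw [← Real.rpow_mul (abs_nonneg _), one_div_mul_cancel hs.ne', Real.rpow_one]
    rw [h4] at h3; exact h3
  -- (c) the conductor relief is below the margin
  have hc : Real.log d / Real.log N < 2 * ε₀ := by
    have h1 : Real.exp (Real.log d / (2 * ε₀) + 1) ≤ N :=
      le_trans (le_trans (le_max_left _ _) (le_max_right _ _)) hN₀N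
    have h2 : Real.log d / (2 * ε₀) + 1 ≤ Real.log N := (Real.le_log_iff_exp_le hNpos).mpr h1
    have h3 : Real.log d / (2 * ε₀) < Real.log N := by linarith
    have h4 : Real.log d < Real.log N * (2 * ε₀) := (div_lt_iff₀ (by positivity)).mp h3
    rw [div_lt_iff₀ hlogN]; linarith
  -- the face at scale N bounds the zero's real part; contradiction with the margin
  have hρle := hface d χ ha ρ hρ hb hre
  have : (η - Real.log d / Real.log N) / 2 > η / 2 - ε₀ := by linarith
  linarith

end Summit.Parity.GeneralizedHardyLittlewood.Theorems.PrimeLevelFamEdgeIdeaDeltas.GaussDiscount
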